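import Summits.QuantumAdvantage.QuantumAdvantage.Theses.CubicForrelation
import Summits.QuantumAdvantage.QuantumAdvantage.Theorems.CubicForrelationNearExactIsExactDerivDegree
import Summits.QuantumAdvantage.QuantumAdvantage.Theorems.CubicForrelationNearExactIsExactRmWeight
import Summits.QuantumAdvantage.QuantumAdvantage.Theorems.CubicForrelationNearExactIsExactMmNormalForm
import Summits.QuantumAdvantage.QuantumAdvantage.Theorems.CubicForrelationNearExactIsExactMmWalsh
import Summits.QuantumAdvantage.QuantumAdvantage.Theorems.CubicForrelationNearExactIsExactMmFormCeiling
import Summits.QuantumAdvantage.QuantumAdvantage.Theorems.CubicForrelationNearExactIsExactAmmNormalForm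
import Summits.QuantumAdvantage.QuantumAdvantage.Theorems.CubicForrelationNearExactIsExactAmmWalsh
import Summits.QuantumAdvantage.QuantumAdvantage.Theorems.CubicForrelationNearExactIsExactFourPoint
import Summits.QuantumAdvantage.QuantumAdvantage.Theorems.CubicForrelationNearExactIsExactRankTwoPencil
import Summits.QuantumAdvantage.QuantumAdvantage.Theorems.CubicForrelationNearExactIsExactAmmAccounting
import Summits.QuantumAdvantage.QuantumAdvantage.Theorems.CubicForrelationNearExactIsExactAmmCeiling

/-!
# BC5 witness for line `codim-two-isolation` of crux `CubicForrelation.NearExactIsExact` (stmt-QuantumAdvantage-14043)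

Standalone, sorry-free: the rungs `k = 0` and `k = 1` of the relative-M-subspace ladder
`RelIsolation k := ∃ θ < 1, ∀ m f g cubic on m+m bits, HasRelMSubspace k g → θ < Φ(f,g) → Φ(f,g) = 1`,
derived from LANDED theorems of the lead's skeleton (`stub_mmNormalForm`, `stub_mmWalsh`, `stub_mmFormCeiling`,
`stub_ammNormalForm`, `stub_ammCeiling` — all closed, namespace
`Summit.QuantumAdvantage.QuantumAdvantage.Theorems.CubicForrelation.NearExactIsExact`).

* `relIsolation_zero : RelIsolation 0` (θ₀ = 31/32) — MM-shaped `g`.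
* `relIsolation_one  : RelIsolation 1` (θ₁ = 1 − 2⁻¹⁰) — almost-MM-shaped `g` (relative codimension 1) = the FIRST RUNG below the open
  rung `CodimTwoIsolation = RelIsolation 2` of `Lines/codim_two_isolation.lean`.

Why it is a witness of weakness (BC5/T3): `RelIsolation 1` is a special case of the crux in a regime (almost-MM `g`, every even `n`)
where neither the crux nor `QuantumAdvantage` is known; it exercises exactly the line's lever (relative normal form → fibrewise
Walsh closed form → shape ceiling), one codimension below the open rung; and `RelIsolation 1 → RelIsolation 2` does not close
cheaply (probe P3 of `bc/CodimTwoIsolation_probe.lean`).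
-/

set_option linter.dupNamespace false

noncomputable section

namespace Summit.QuantumAdvantage.QuantumAdvantage.Cruxes.NearExactIsExact.CodimTwoIsolation.Special

open Finset
open Literature.Computability.QuantumComplexity
open Literature.Computability.QuantumComplexity.BuzetChailloux (bxor zeroVec signOf_sq)
open Summit.QuantumAdvantage.QuantumAdvantage.Theses.CubicForrelation (NearExactIsExact)

variable {n : ℕ}

/-! ## §0 Vocabulary -/

/-- `g` has a **relative M-subspace of codimension `k`**: an xor-closed finset `V ∋ 0` with `|V|²·4ᵏ = 2ⁿ`
(`dim V = n/2 − k`) on every coset of which `g` is affine (all second differences along `V` vanish).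
`k = 0`: the lead's `HasMSubspace` (`|V|² = 2ⁿ`); `k = 1`: the lead's `HasAMSubspace` (`4|V|² = 2ⁿ`). -/
def HasRelMSubspace (k : ℕ) (g : (Fin n → Bool) → Bool) : Prop :=
  ∃ V : Finset (Fin n → Bool), zeroVec ∈ V ∧ (∀ x ∈ V, ∀ y ∈ V, bxor x y ∈ V) ∧ V.card * V.card * 4 ^ k = 2 ^ n ∧
    ∀ u ∈ V, ∀ v ∈ V, ∀ y, (g y ^^ g (bxor y u) ^^ g (bxor y v) ^^ g (bxor y (bxor u v))) = false

/-- **Rung `k` of the ladder**: isolation of exactness for cubic pairs whose `g`-side has relative defect `k`. -/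
def RelIsolation (k : ℕ) : Prop :=
  ∃ θ : ℝ, θ < 1 ∧ ∀ (m : ℕ) (f g : (Fin (m + m) → Bool) → Bool), IsDegLeFun 3 f → IsDegLeFun 3 g →
    HasRelMSubspace k g → θ < forrelation f g → forrelation f g = 1

/-- **The rung filed by this line** (`k = 2`; `k = 0, 1` are theorems below). -/
def CodimTwoIsolation : Prop := RelIsolation 2

/-- **The gap after the rung**: the crux on pairs with no codimension-2 relative M-subspace on either side. -/
def LargeDefectGap : Prop :=
  ∃ θ : ℝ, θ < 1 ∧ ∀ (m : ℕ) (f g : (Fin (m + m) → Bool) → Bool), IsDegLeFun 3 f → IsDegLeFun 3 g →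
    ¬ HasRelMSubspace 2 f → ¬ HasRelMSubspace 2 g → θ < forrelation f g → forrelation f g = 1


/-! ## §2 The proved rungs `k = 0, 1` (sorry-free, from landed Theorems) -/

/-- `Φ(f,g) = Φ(g,f)` (the twist is symmetric). [folklore; as in the lead skeleton] -/
theorem forrelation_comm (f g : (Fin n → Bool) → Bool) : forrelation f g = forrelation g f := by
  unfold forrelation
  congr 1
  rw [Finset.sum_comm]
  refine Finset.sum_congr rfl fun y _ => Finset.sum_congr rfl fun x _ => ?_
  rw [twist_comm]; ring

open Summit.QuantumAdvantage.QuantumAdvantage.Theorems.CubicForrelation.NearExactIsExact in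
/-- **Rung 0 as a ceiling** (landed N, F1, F2 fed with D, R): `HasRelMSubspace 0 g`, `f g` cubic ⇒ `Φ = 1 ∨ Φ ≤ 31/32`. -/
theorem mmShapeCeiling (m : ℕ) (f g : (Fin (m + m) → Bool) → Bool) (hf : IsDegLeFun 3 f) (hg : IsDegLeFun 3 g)
    (hM : HasRelMSubspace 0 g) : forrelation f g = 1 ∨ forrelation f g ≤ 31 / 32 := by
  obtain ⟨V, hV0, hVx, hVc, hD4⟩ := hM
  rw [pow_zero, mul_one] at hVc
  obtain ⟨f₁, g₁, π, h, hf₁, hπ, hh, hsign, hΦ⟩ :=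
    stub_mmNormalForm stub_derivDegree m f g hf hg ⟨V, hV0, hVx, hVc, hD4⟩
  rw [← hΦ]
  exact stub_mmFormCeiling stub_derivDegree (stub_rmWeight stub_derivDegree) stub_mmWalsh m f₁ g₁ π h hf₁ hπ hh hsign

/-- **Rung 0** (`RelIsolation 0`, θ = 31/32): PROVED. -/
theorem relIsolation_zero : RelIsolation 0 := by
  refine ⟨31 / 32, by norm_num, ?_⟩
  intro m f g hf hg hM hθ
  rcases mmShapeCeiling m f g hf hg hM with h | h
  · exact h
  · exfalso; linarith

open Summit.QuantumAdvantage.QuantumAdvantage.Theorems.CubicForrelation.NearExactIsExact in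
/-- **Rung 1 as a ceiling** (landed AN, AC fed with D, R, AW, FP, RP, AA): `HasRelMSubspace 1 g`, `f g` cubic ⇒
`Φ = 1 ∨ Φ ≤ 1 − 2⁻¹⁰ ∨ HasRelMSubspace 0 g`. -/
theorem ammShapeCeiling (m : ℕ) (f g : (Fin (m + m) → Bool) → Bool) (hf : IsDegLeFun 3 f) (hg : IsDegLeFun 3 g)
    (hAM : HasRelMSubspace 1 g) : forrelation f g = 1 ∨ forrelation f g ≤ 1 - 1 / 1024 ∨ HasRelMSubspace 0 g := by
  obtain ⟨V, hV0, hVx, hVc, hD4⟩ := hAM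
  rw [pow_one] at hVc
  obtain ⟨a, rfl⟩ : ∃ a, m = a + 1 := by
    have h4 : 4 ∣ 2 ^ (m + m) := ⟨V.card * V.card, by rw [← hVc]; ring⟩
    refine ⟨m - 1, ?_⟩
    rcases Nat.lt_or_ge m 1 with hm | hm
    · interval_cases m; norm_num at h4
    · omega
  obtain ⟨f₁, g₁, φ, h, hf₁, hφ, hh, hsign, hΦ, hback⟩ :=
    stub_ammNormalForm stub_derivDegree a f g hf hg ⟨V, hV0, hVx, hVc, hD4⟩
  rcases stub_ammCeiling stub_derivDegree (stub_rmWeight stub_derivDegree) stub_ammWalsh stub_fourPoint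
      stub_rankTwoPencil stub_ammAccounting a f₁ g₁ φ h hf₁ hφ hh hsign with h1 | h2 | h3
  · left; rw [← hΦ]; exact h1
  · right; left; rw [← hΦ]; exact h2
  · right; right
    obtain ⟨V', hV0', hVx', hVc', hD4'⟩ := hback h3
    exact ⟨V', hV0', hVx', by rw [pow_zero, mul_one]; exact hVc', hD4'⟩

/-- **Rung 1** (`RelIsolation 1`, θ = 1 − 2⁻¹⁰): PROVED — the BC5 witness of the ladder (first rung below the filed one). -/
theorem relIsolation_one : RelIsolation 1 := by
  refine ⟨1 - 1 / 1024, by norm_num, ?_⟩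
  intro m f g hf hg hAM hθ
  rcases ammShapeCeiling m f g hf hg hAM with h | h | h
  · exact h
  · exfalso; linarith
  · rcases mmShapeCeiling m f g hf hg h with h' | h'
    · exact h'
    · exfalso; linarith


end Summit.QuantumAdvantage.QuantumAdvantage.Cruxes.NearExactIsExact.CodimTwoIsolation.Special
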